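import Summits.HodgeConjecture.CorCM.HypDel.ExtAmbientReceptacleQArchA
import Literature.AlgebraicGeometry.ShimuraVarieties.UnitaryAuxiliaryTorusClassNumberProofs
import Literature.AlgebraicGeometry.Motives.FiniteCoproductVarieties
import Literature.AlgebraicGeometry.Motives.FiniteQuotientQuasiProjective
import HarnessLib

/-!
# T3 `stub_Squot` — «Y-PACK»: geometry of the SOURCE `Sh_{K_V × L_V}(G × T₀(M), X × {h_Φ})_ℂ` of the product-level closed immersion

Cell `hodgecm-mathlib`, crux `HDel` (stmt-HodgeConjecture-24835), T3 v4.3 (B-plan2), `stub_Squot` table (lead B-p01 g6,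
2026-08-28T16:24:28Z (C) → B-p18 g9).  THEOREMS ONLY; no definition, no named fact, no instance, nothing asserted.

For a complex record system `Sc` of the compact unitary Shimura variety and the twisted auxiliary torus datum, the complex Shimura
variety of the PRODUCT datum at level `K × L₀` is `Y := (complexSystemExt M Sc L₀).obj K = ∐_{p ∈ T₀(ℚ)\T₀(𝔸_f)/L₀} Sc.Mc_K`
(★ `Aux.complexSystemExt`, [Deligne1979ShimuraVarieties] 2.1.2).  The `stub_Squot` closer (RECEPTACLE-PLAN §7.2 Step D, ★ Q1
`Motives.exists_isClosedImmersion_desc_of_isSepQuotient`) needs of the source exactly: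

* `isProjectiveOver_complexSystemExt_obj` — `Y` is projective over `ℂ` (a FINITE coproduct, ★ `Aux.finite_classGroup_printed_holds`
  [BorelIHES1963 Thm 5.1], of the projective `Sc.Mc_K`, ★ `Motives.isProjectiveOver_of_isColimit_cofan`);
* `isQuasiProjectiveOver_complexSystemExt_obj`, `isProper_complexSystemExt_obj_hom`, **`isSeparated_complexSystemExt_obj_hom`**
  (any level — serves both `Y` and the target level `Y′ = (complexSystemExt M Sc L₀).obj K` of the level change);
* `smoothOfRelativeDimension_complexSystemExt_obj`, `isReduced_complexSystemExt_obj_left`, `locallyOfFiniteType_complexSystemExt_obj_hom`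
  (what «points determine morphisms» on `Y` consumes);
* **`forall_exists_stableAffineOpen_complexSystemExt_obj`** — for ANY action `actΔ : Δ →* Aut Y` of a finite group by
  `ℂ`-automorphisms, every point of `Y` lies in a `Δ`-stable affine open (Mumford's covering hypothesis, automatic for projective
  `Y`: ★ `ActionOver.forall_exists_stableAffineOpen_of_isProjectiveOver`, SGA 1 V 1.8) — the literal `hcovY` binder of ★ Q1, with
  the action written inline as `⟨((Over.forget _).mapAut Y).comp actΔ, fun g => Over.w (actΔ g).hom⟩` exactly as Q1/Q5 spell it.

HC_CM is proved only modulo the 7 printed citations until rung 0 closes; nothing here proves I-1′ or `HDel`.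
[cite: Deligne1979ShimuraVarieties, 2.1.2 and 2.1.4 (PDF p. 24 of Milne's translation)] [cite: Deligne1971TravauxShimura, §5 (5.11.1) p. 159]
[cite: MumfordAV1970, §7 Thm. p. 66] [cite: SGA1, Exp. V, Prop. 1.8] [cite: BorelIHES1963, §5 Thm. 5.1]
-/

noncomputable section

open Function MulAction Topology NumberField IsDedekindDomain CategoryTheory CategoryTheory.Limits Matrix
  AlgebraicGeometry
open scoped Matrix ComplexOrder
open Literature.AlgebraicGeometry Literature.AlgebraicGeometry.Motives
open Literature.AlgebraicGeometry.RelativeSpec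
open Literature.NumberTheory.Automorphic Literature.NumberTheory.Automorphic.UnitaryGroup
open Literature.NumberTheory.Automorphic.Liu2021.AppendixC (C5.OpenCompactSubgroup C5.SmallLevel)
open Literature.Geometry.ComplexHyperbolic Literature.Geometry.ComplexHyperbolic.BallModel
open Literature.AlgebraicGeometry.ShimuraVarieties Literature.AlgebraicGeometry.ShimuraVarieties.UnitaryCanonicalModel
open Literature.AlgebraicGeometry.ShimuraVarieties.UnitaryCanonicalModel.Aux
open Literature.AlgebraicGeometry.HodgeTheory (IsQuasiProjectiveOver)

namespace Summit.HodgeConjecture.CorCM.HypDel.ExtReceptacle.QArch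

set_option autoImplicit false

section Source

variable {L : Type} [Field L] [NumberField L] [IsCMField L]
variable {H : Matrix (Fin 3) (Fin 3) L} {τ : L →+* ℂ} {T : GL (Fin 3) ℂ}
  {hT : formCongr (starRingEnd ℂ) T (H.map τ) = BallModel.J}
  {K₀ : C5.OpenCompactSubgroup ↥(finAdelic (↥(maximalRealSubfield L)) L (IsCMField.complexConj L) 3 H)}
variable (M : Type) [Field M] [NumberField M] [IsCMField M]

/-- The defining colimit cofan of `Sh_{K × L₀}(G × T₀(M), X × {h_Φ})_ℂ = ∐_p Sc.Mc_K` (★ `Aux.complexSystemExt`, a `Sigma`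
object; `coproductIsCoproduct`). [cite: Deligne1979ShimuraVarieties, 2.1.2 (PDF p. 24 of Milne's translation)] -/
theorem isColimit_cofan_complexSystemExt_obj (Sc : ComplexRecordSystem L H τ T hT K₀)
    (L₀ : C5.OpenCompactSubgroup ↥(torusFinAdelic M)) (K : C5.SmallLevel K₀) :
    Nonempty (IsColimit (Cofan.mk ((complexSystemExt M Sc L₀).obj K)
      (Sigma.ι (fun _ : classGroup M L₀ => Sc.Mc.obj K)))) :=
  ⟨coproductIsCoproduct _⟩

/-- **`Sh_{K × L₀}(G × T₀(M), X × {h_Φ})_ℂ` is PROJECTIVE over `ℂ`**: a finite (★ `Aux.finite_classGroup_printed_holds`, the class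
number of `T₀`) disjoint union of the projective `Sc.Mc_K` (compact unitary Shimura surfaces).
[cite: Deligne1979ShimuraVarieties, 2.1.2 (PDF p. 24 of Milne's translation)] [cite: BorelIHES1963, §5 Thm. 5.1 (p. 19)] -/
theorem isProjectiveOver_complexSystemExt_obj (Sc : ComplexRecordSystem L H τ T hT K₀)
    (L₀ : C5.OpenCompactSubgroup ↥(torusFinAdelic M)) (K : C5.SmallLevel K₀) :
    IsProjectiveOver ((complexSystemExt M Sc L₀).obj K) := by
  haveI : Finite (classGroup M L₀) := finite_classGroup_printed_holds M L₀
  exact isProjectiveOver_of_isColimit_cofan (coproductIsCoproduct _) fun _ => Sc.projective K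

/-- `Sh_{K × L₀}(G × T₀(M), X × {h_Φ})_ℂ` is quasi-projective over `ℂ` (projective ⇒ quasi-projective).
[cite: Deligne1979ShimuraVarieties, 2.1.2 (PDF p. 24 of Milne's translation)] -/
theorem isQuasiProjectiveOver_complexSystemExt_obj (Sc : ComplexRecordSystem L H τ T hT K₀)
    (L₀ : C5.OpenCompactSubgroup ↥(torusFinAdelic M)) (K : C5.SmallLevel K₀) :
    IsQuasiProjectiveOver ((complexSystemExt M Sc L₀).obj K) :=
  IsQuasiProjectiveOver.of_isProjectiveOver (isProjectiveOver_complexSystemExt_obj M Sc L₀ K)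

/-- `Sh_{K × L₀}(G × T₀(M), X × {h_Φ})_ℂ → Spec ℂ` is proper. [cite: Deligne1979ShimuraVarieties, 2.1.2 (PDF p. 24 of Milne's translation)] -/
theorem isProper_complexSystemExt_obj_hom (Sc : ComplexRecordSystem L H τ T hT K₀)
    (L₀ : C5.OpenCompactSubgroup ↥(torusFinAdelic M)) (K : C5.SmallLevel K₀) :
    IsProper ((complexSystemExt M Sc L₀).obj K).hom :=
  (isProjectiveOver_complexSystemExt_obj M Sc L₀ K).isProper

/-- **`Sh_{K × L₀}(G × T₀(M), X × {h_Φ})_ℂ → Spec ℂ` is SEPARATED** (proper ⇒ separated) — at every level, so it serves both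
the source `K_V × L_V` and the target `K × L₀` of the level change (the `hY′` binder of ★ Q1).
[cite: Deligne1979ShimuraVarieties, 2.1.2 and 2.1.4 (PDF p. 24 of Milne's translation)] -/
theorem isSeparated_complexSystemExt_obj_hom (Sc : ComplexRecordSystem L H τ T hT K₀)
    (L₀ : C5.OpenCompactSubgroup ↥(torusFinAdelic M)) (K : C5.SmallLevel K₀) :
    IsSeparated ((complexSystemExt M Sc L₀).obj K).hom := by
  haveI := isProper_complexSystemExt_obj_hom M Sc L₀ K
  infer_instance

/-- `Sh_{K × L₀}(G × T₀(M), X × {h_Φ})_ℂ` is smooth of relative dimension `2` over `ℂ` (each summand is, (C1) of the record system;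
★ `Motives.smoothOfRelativeDimension_of_isColimit_cofan`). [cite: Deligne1979ShimuraVarieties, 2.1.2 (PDF p. 24 of Milne's translation)] -/
theorem smoothOfRelativeDimension_complexSystemExt_obj (Sc : ComplexRecordSystem L H τ T hT K₀)
    (L₀ : C5.OpenCompactSubgroup ↥(torusFinAdelic M)) (K : C5.SmallLevel K₀) :
    SmoothOfRelativeDimension 2 ((complexSystemExt M Sc L₀).obj K).hom :=
  smoothOfRelativeDimension_of_isColimit_cofan (coproductIsCoproduct _) fun _ => Sc.smooth K

/-- `Sh_{K × L₀}(G × T₀(M), X × {h_Φ})_ℂ → Spec ℂ` is smooth. [cite: Deligne1979ShimuraVarieties, 2.1.2 (PDF p. 24 of Milne's translation)] -/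
theorem smooth_complexSystemExt_obj_hom (Sc : ComplexRecordSystem L H τ T hT K₀)
    (L₀ : C5.OpenCompactSubgroup ↥(torusFinAdelic M)) (K : C5.SmallLevel K₀) :
    Smooth ((complexSystemExt M Sc L₀).obj K).hom := by
  haveI := smoothOfRelativeDimension_complexSystemExt_obj M Sc L₀ K
  exact SmoothOfRelativeDimension.smooth 2 _

/-- `Sh_{K × L₀}(G × T₀(M), X × {h_Φ})_ℂ → Spec ℂ` is locally of finite type (smooth ⇒ locally of finite presentation ⇒ lfT).
[cite: Deligne1979ShimuraVarieties, 2.1.2 (PDF p. 24 of Milne's translation)] -/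
theorem locallyOfFiniteType_complexSystemExt_obj_hom (Sc : ComplexRecordSystem L H τ T hT K₀)
    (L₀ : C5.OpenCompactSubgroup ↥(torusFinAdelic M)) (K : C5.SmallLevel K₀) :
    LocallyOfFiniteType ((complexSystemExt M Sc L₀).obj K).hom := by
  haveI := smooth_complexSystemExt_obj_hom M Sc L₀ K
  infer_instance

/-- `Sh_{K × L₀}(G × T₀(M), X × {h_Φ})_ℂ` is REDUCED (smooth over a field). [cite: Deligne1979ShimuraVarieties, 2.1.2 (PDF p. 24 of Milne's translation)] -/
theorem isReduced_complexSystemExt_obj_left (Sc : ComplexRecordSystem L H τ T hT K₀)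
    (L₀ : C5.OpenCompactSubgroup ↥(torusFinAdelic M)) (K : C5.SmallLevel K₀) :
    IsReduced ((complexSystemExt M Sc L₀).obj K).left := by
  haveI := smooth_complexSystemExt_obj_hom M Sc L₀ K
  exact isReduced_of_smooth_over_field ((complexSystemExt M Sc L₀).obj K).hom

/-- **Mumford's covering hypothesis for the source (`hcovY` of ★ Q1)**: for ANY action `actΔ : Δ →* Aut_ℂ(Y)` of a finite group
on `Y = Sh_{K × L₀}(G × T₀(M), X × {h_Φ})_ℂ`, every point of `Y` lies in a `Δ`-stable affine open (automatic for projective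
`Y`: SGA 1 V Prop. 1.8 / Mumford AV §7 p. 66 — ★ `ActionOver.forall_exists_stableAffineOpen_of_isProjectiveOver`).  The action is
spelled inline as the `RelativeSpec.ActionOver` `⟨((Over.forget _).mapAut Y).comp actΔ, fun g => Over.w (actΔ g).hom⟩`, token-for-token
as in ★ Q1 `exists_isClosedImmersion_desc_of_isSepQuotient` / ★ Q5. [cite: MumfordAV1970, §7 Thm. p. 66] [cite: SGA1, Exp. V, Prop. 1.8] -/
theorem forall_exists_stableAffineOpen_complexSystemExt_obj (Sc : ComplexRecordSystem L H τ T hT K₀)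
    (L₀ : C5.OpenCompactSubgroup ↥(torusFinAdelic M)) (K : C5.SmallLevel K₀) {Δ : Type} [Group Δ] [Finite Δ]
    (actΔ : Δ →* Aut ((complexSystemExt M Sc L₀).obj K)) (y : ((complexSystemExt M Sc L₀).obj K).left) :
    ∃ O : (⟨((Over.forget _).mapAut ((complexSystemExt M Sc L₀).obj K)).comp actΔ, fun g => Over.w (actΔ g).hom⟩ :
        ActionOver ((complexSystemExt M Sc L₀).obj K).hom Δ).StableAffineOpens, y ∈ O.1 :=
  ActionOver.forall_exists_stableAffineOpen_of_isProjectiveOver _ (isProjectiveOver_complexSystemExt_obj M Sc L₀ K) y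

/-- The cardinality of a finite group is invertible in `ℂ` (characteristic zero) — the `hk`/`hcard` binder of ★ Q1 for the source side.
[cite: MumfordAV1970, §7 Thm. p. 66] -/
theorem natCard_ne_zero_complex (Δ : Type) [Finite Δ] [Nonempty Δ] : (Nat.card Δ : ℂ) ≠ 0 :=
  Nat.cast_ne_zero.2 Nat.card_pos.ne'

end Source

end Summit.HodgeConjecture.CorCM.HypDel.ExtReceptacle.QArch

end
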